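import Summits.AtomisticToContinuum.Crystallization.Theorems.ChargedEnergyGapChartDialZB
import Literature.Geometry.DiscreteGeometry.ShellCensusSearchFinal

/-!
# `ChargedEnergyGap` · the CHART DIAL, part ZC: THE BOND GRAPH OF A SCALE-FREE DOZEN — [G] PROVED
(decomp-a2c lens-3 g39 node «ChargeFreeGap»; the last input of the [G] port plan)

The census call.  Part ZB delivers, for every scale-free dozen, the twelve fields of the tree's abstract census frame
`ShellCensusSearch.CF` (`Literature/Geometry/DiscreteGeometry/ShellCensusSearchFrame.lean`); the tree's census theorem
`ShellCensusSearch.CF.concl` (`…ShellCensusSearchFinal.lean`, the verified two-phase growth search) says that up to a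
relabelling the bond graph is `patAdj 0 / 1 / 2`; and the tree's dictionary `patAdj0_iff` / `patAdj1_iff` (squared integer
bonds `2` / `18` of `fccVec` / `hcpVec`) + part ZB §3 (`dist (fccTuple v) (fccTuple w) = 1 ↔ …`), resp. `patAdj2_iff` (the edge
list `apPairs`, which IS part Q's `apList`), turn the three cases into `TupleIso B σ fccTuple`, `TupleIso B σ hcpTuple`,
`AntiprismIso B σ`.  Hence:

* `IsScaleFreeDozen.bondGraph`, ★ `dozenBondGraphs_tuples : DozenBondGraphs fccTuple hcpTuple` — piece [G] of the bond-graph split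
  (part Q) for the canonical pattern tuples `ShellCensus.fccTuple / hcpTuple` (`image_fccTuple / image_hcpTuple`);
* `twelveShellShaped_of_noAntiprism_graphedClose`: [A] `NoAntiprismDozen` + [C] `GraphedDozenClose θ fccTuple / hcpTuple` ⇒
  `TwelveShellShaped θ`, and the line of record `chartedChargePricing_of_far_cleanApproachHarnack_AC` (`θ ≤ 3/20`).

Axioms: those of `CF.concl` (the census run uses `native_decide`: `Lean.ofReduceBool`), otherwise standard.
No `sorry`, no instance / notation / option; no new definitions.
-/

noncomputable section

open scoped RealInnerProductSpace
open Literature.MathematicalPhysics.StatisticalMechanics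
open Literature.Geometry.DiscreteGeometry
open Literature.Geometry.DiscreteGeometry.ShellCensus
open Summit.AtomisticToContinuum.Crystallization.Theses.PricedLinkCensus
open Summit.AtomisticToContinuum.Crystallization.Theorems.ChargedEnergyGapNegative

namespace Summit.AtomisticToContinuum.Crystallization.Theorems.ChargedEnergyGapChartDial

/-! ## §1 The census frame of a scale-free dozen -/

/-- **A scale-free dozen carries a census frame** whose bond table is (the Boolean table of) its bond relation. -/
theorem IsScaleFreeDozen.exists_frame {t : Fin 12 → E3} {B : Fin 12 → Fin 12 → Prop} (hD : IsScaleFreeDozen t B) :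
    ∃ M : ShellCensusSearch.CF, ∀ v w, M.bond v w = true ↔ B v w := by
  classical
  obtain ⟨f1, f2, f3, f4, f5, f6, f7, f8, f9, f10, f11, f12⟩ :=
    hD.censusFacts _ rfl _ rfl _ rfl _ rfl (fun v w => decide (B v w)) fun v w => decide_eq_true_iff
  exact ⟨⟨fun v w => decide (B v w), _, f1, f2, f3, f4, f5, f6, f7, f8, f9, f10, f11, f12⟩,
    fun v w => decide_eq_true_iff⟩

/-! ## §2 The pattern dictionary and [G] -/

/-- Part Q's antiprism edge list is the census's. -/
theorem apList_eq_apPairs : apList = ShellCensusSearch.apPairs := rfl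

/-- **The bond graph of a scale-free dozen** is, up to a relabelling, the unit-distance graph of `fccTuple`, that of
`hcpTuple`, or the labelled antiprism. -/
theorem IsScaleFreeDozen.bondGraph {t : Fin 12 → E3} {B : Fin 12 → Fin 12 → Prop} (hD : IsScaleFreeDozen t B) :
    ∃ σ : Equiv.Perm (Fin 12), TupleIso B σ fccTuple ∨ TupleIso B σ hcpTuple ∨ AntiprismIso B σ := by
  obtain ⟨M, hM⟩ := hD.exists_frame
  have hc : ∃ σ : Equiv.Perm (Fin 12), ∃ i, i < 3 ∧
      ∀ v w : Fin 12, v ≠ w → (M.bond (σ v) (σ w) = true ↔ ShellCensusSearch.patAdj i v w = true) :=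
    ShellCensusSearch.CF.concl M
  obtain ⟨σ, i, hi, h⟩ := hc
  refine ⟨σ, ?_⟩
  interval_cases i
  · refine Or.inl fun v w hvw => ?_
    rw [← hM, h v w hvw, ShellCensusSearch.patAdj0_iff, dist_fccTuple_eq_one_iff]
    norm_num
  · refine Or.inr (Or.inl fun v w hvw => ?_)
    rw [← hM, h v w hvw, ShellCensusSearch.patAdj1_iff, dist_hcpTuple_eq_one_iff]
    norm_num
  · refine Or.inr (Or.inr fun v w hvw => ?_)
    rw [← hM, h v w hvw, ShellCensusSearch.patAdj2_iff v w hvw, apList_eq_apPairs]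

/-- ★ **[G] for the canonical pattern tuples**: the bond graph of every scale-free dozen is, up to a relabelling, the
unit-distance graph of `fccTuple`, that of `hcpTuple`, or the labelled antiprism. -/
theorem dozenBondGraphs_tuples : DozenBondGraphs fccTuple hcpTuple := fun _ _ hD => hD.bondGraph

/-! ## §3 Hypothesis 3 of record from [A] and [C] -/

/-- **The finite shape statement from [A] and [C]** (the bond-graph split of part Q with [G] discharged). -/
theorem twelveShellShaped_of_noAntiprism_graphedClose {θ : ℝ} (hA : NoAntiprismDozen)
    (h0 : GraphedDozenClose θ fccTuple) (h1 : GraphedDozenClose θ hcpTuple) : TwelveShellShaped θ :=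
  twelveShellShaped_of_bondGraphs image_fccTuple image_hcpTuple dozenBondGraphs_tuples hA h0 h1

/-- **The line of record through [A] and [C]** (`θ ≤ 3/20`): far-field pricing + clean-approach Harnack + no antiprism dozen
+ graphed closeness to `fccTuple` and to `hcpTuple` ⇒ `ChartedChargePricing θ`. -/
theorem chartedChargePricing_of_far_cleanApproachHarnack_AC {θ R M₀ M₁ : ℝ} (hθ : θ ≤ 3 / 20) (hR : 0 < R)
    (hM₀ : 0 ≤ M₀) (hFP : FarFieldPricing θ R) (hH : CleanApproachHarnack θ R M₀ M₁) (hA : NoAntiprismDozen)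
    (h0 : GraphedDozenClose θ fccTuple) (h1 : GraphedDozenClose θ hcpTuple) : ChartedChargePricing θ :=
  chartedChargePricing_of_far_cleanApproachHarnack_graphs hθ hR hM₀ hFP hH image_fccTuple image_hcpTuple
    dozenBondGraphs_tuples hA h0 h1

end Summit.AtomisticToContinuum.Crystallization.Theorems.ChargedEnergyGapChartDial

end
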